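import Literature.NumberTheory.Automorphic.AdditiveCharacterDuality      -- ★ `AddCharDuality.exists_mulShift_level_one` (Bump Ex. 3.1.1 (b)); brings `AddChar.IsContinuousNontrivial` (★ `TateLocalFactors`)
import Literature.NumberTheory.Automorphic.AdeleAddCharLocalNontrivial    -- ★ `isContinuousNontrivial_adeleAddCharAt` (Tate Lemma 2.2.3): the local component `ψ_v` of Tate's character is continuous and non-trivial
import Literature.NumberTheory.Automorphic.AdicCompletionLocalField       -- ★ instances `ValuativeRel` ∕ `IsNonarchimedeanLocalField (v.adicCompletion K)`
import Literature.NumberTheory.Automorphic.HeckeTransversalGL             -- ★ `IsUniformizingElement`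
import HarnessLib

/-!
# Crux `H413` — K2-LIT E3 «EllipticInputs», U12-h brick (Psi): A LOCAL ADDITIVE CHARACTER OF CONDUCTOR EXACTLY `𝒪` — for every non-archimedean local field carrying a
# non-trivial continuous additive character, in particular for every completion `K_v` of a number field: `∃ ψ : AddChar F Circle`, trivial on `𝒪 = {v ≤ 1}` and NOT trivial on
# `ϖ⁻¹𝒪 = {v ≤ |ϖ|⁻¹}` — the letters `hψ` ∕ `hψ'` of the congruence-layer bricks ★ (S) (H-char) (C) (N)

Cell `hodgecm-mathlib`, Track B «K2-LIT», crux item `stmt-HodgeConjecture-24833` (h413), line `K2_E3_EllipticInputs`, unit U12 «HC characters», socket U12-h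
`sig_K2E3CharLocConstNearRegular` (‹#9L›), depth-halving road; instantiation brick (Psi) dealt BY NAME by the 9L line lead K2E3-p09 (g2) to seat K2E4-p02 (g2) (K2 bus
2026-09-03T23:59:12Z); `--supports stmt-HodgeConjecture-24833 --as helper`.  THEOREMS ONLY — no `def`, no named fact, no instance, no notation, no `sorry`.  It DISCHARGES the two hypotheses
`(hψ : ∀ x : F, valuation F x ≤ 1 → ψ x = 1)` and `(hψ' : ∃ x : F, valuation F x ≤ (valuation F ϖ)⁻¹ ∧ ψ x ≠ 1)` carried by ★ `K2E3CongruenceLayerAdapters.exists_valBound_and_forall_eq_coe_map_trace` (S),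
★ `K2E3CongruenceLayerIntertwiningGL.valBound_conj_sub_of_intertwines_on_overlap` (C), ★ `K2E3CongruenceLayerOccurrenceNilpotentGL.exists_nilpotent_add_valBound_of_occurrence` (N) and the
(P-GL) parameter package, at `F := w.adicCompletion L` (any finite place `w` of the CM field `L`, or of any number field).  HONEST LABEL: HC_CM is proved only modulo the 7 printed citations
(2 remaining named inputs: hLiu418 = stmt-HodgeConjecture-24832, h413 = stmt-HodgeConjecture-24833) until rung 0 closes; count-neutral plumbing.

THE MATHEMATICS [Bump1997, Exercise 3.1.1 (b); BushnellHenniart2006, §1.7; CasselsFrohlichANT1967, Ch. XV (Tate) Lemma 2.2.3; WeilBNT1967, Ch. II §5, Ch. IV §2].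
* §1 GENERIC `F` (non-archimedean local field, `ϖ` a uniformizing element): a continuous non-trivial `ψ₀` can be rescaled to LEVEL ONE (★ `exists_mulShift_level_one`: `ψ₀(t·)` trivial on `𝓂`,
  not on `𝒪`); one more rescaling by `ϖ` gives `ψ := ψ₀((tϖ)·)` TRIVIAL ON `𝒪` and NON-TRIVIAL at `ϖ⁻¹y₀ ∈ ϖ⁻¹𝒪` — «conductor exactly `𝒪`» in the valuation letters of the bricks
  (`exists_addChar_conductor_integers_of_isContinuousNontrivial`, with continuity kept; `…_of_exists` drops it to the bare two letters).  The witness serves EVERY `ϖ′` with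
  `valuation F ϖ′ < 1` at once (`exists_addChar_conductor_integers_forall`), since `|ϖ′| ≤ |ϖ|`.
* §2 NUMBER FIELDS: at a finite place `v` of a number field `K` the local component `ψ_v` of Tate's character `ψ_K` of `𝔸_K ⧸ K` is continuous and non-trivial (★ `isContinuousNontrivial_adeleAddCharAt`),
  so §1 applies to `F := v.adicCompletion K` (★ instance `instIsNonarchimedeanLocalFieldAdicCompletion`): `exists_addChar_adicCompletion` (the two letters verbatim),
  `exists_continuous_addChar_adicCompletion` (with continuity), `exists_addChar_adicCompletion_forall` (uniformizer-free).

## References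
* [Bump1997] D. Bump, *Automorphic Forms and Representations* (1997), Exercise 3.1.1 (b) (PDF p. 266) (level of an additive character; rescaling).
* [BushnellHenniart2006] C. J. Bushnell, G. Henniart, *The Local Langlands Conjecture for GL(2)* (2006), §1.7 (level ∕ conductor of `ψ`; additive duality).
* [CasselsFrohlichANT1967] J. Tate, *Fourier analysis in number fields and Hecke's zeta-functions*, Ch. XV of Cassels–Fröhlich (1967), Lemma 2.2.3, §4.1 (`ψ_v` non-trivial, conductor `𝔡_v⁻¹`).
* [WeilBNT1967] A. Weil, *Basic Number Theory* (1967), Ch. II §5 (characters of local fields), Ch. IV §2.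
-/

set_option autoImplicit false
-- the mandated namespace repeats `HodgeConjecture.HodgeConjecture`, as in every `Theorems/*.lean` of this sub-problem
set_option linter.dupNamespace false

noncomputable section

open ValuativeRel Literature.NumberTheory.Automorphic

namespace Summit.HodgeConjecture.HodgeConjecture.Cruxes.H413.K2E3LocalAdditiveCharacterLevelOne

/-! ## §1 Generic: rescaling a non-trivial continuous character to conductor exactly `𝒪` -/

section Generic

variable {F : Type*} [Field F] [ValuativeRel F] [TopologicalSpace F] [IsNonarchimedeanLocalField F]

/-- A rescaled additive character `ψ(a·)` of a topological field is continuous when `ψ` is. [folklore] -/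
theorem continuous_mulShift {ψ : AddChar F Circle} (hψ : Continuous ψ) (a : F) : Continuous (ψ.mulShift a) := by
  have h : (⇑(ψ.mulShift a) : F → Circle) = fun x => ψ (a * x) := funext fun x => AddChar.mulShift_apply
  rw [h]
  exact hψ.comp (continuous_const.mul continuous_id)

/-- **CONDUCTOR EXACTLY `𝒪` FROM ANY NON-TRIVIAL CONTINUOUS CHARACTER.**  `F` a non-archimedean local field, `ϖ` a uniformizing element, `ψ₀ : F → 𝕊` continuous and non-trivial.  Then there is a
continuous `ψ : AddChar F Circle` with `ψ x = 1` whenever `valuation F x ≤ 1` and `ψ x ≠ 1` for some `x` with `valuation F x ≤ (valuation F ϖ)⁻¹`: take `ψ := ψ₀((tϖ)·)` where `ψ₀(t·)` has level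
one (★ `AddCharDuality.exists_mulShift_level_one`). [cite: Bump1997, Exercise 3.1.1 (b) (PDF p. 266)] [cite: BushnellHenniart2006, §1.7] -/
theorem exists_continuous_addChar_conductor_integers_of_isContinuousNontrivial {ϖ : F} (hϖ : IsUniformizingElement ϖ) {ψ₀ : AddChar F Circle}
    (hψ₀ : ψ₀.IsContinuousNontrivial) :
    ∃ ψ : AddChar F Circle, Continuous ψ ∧ (∀ x : F, valuation F x ≤ 1 → ψ x = 1) ∧ ∃ x : F, valuation F x ≤ (valuation F ϖ)⁻¹ ∧ ψ x ≠ 1 := by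
  have hirr : Irreducible (⟨ϖ, hϖ.mem⟩ : 𝒪[F]) := (IsDiscreteValuationRing.irreducible_iff_uniformizer _).mpr hϖ.span_eq
  obtain ⟨t, -, h𝓂, y₀, hy₀⟩ := AddCharDuality.exists_mulShift_level_one hirr hψ₀
  have hϖ0 : ϖ ≠ 0 := hϖ.ne_zero
  refine ⟨ψ₀.mulShift (t * ϖ), continuous_mulShift hψ₀.1 _, fun x hx => ?_, ⟨ϖ⁻¹ * y₀, ?_, ?_⟩⟩
  · -- `x ∈ 𝒪 ⇒ ϖx ∈ 𝓂 ⇒ ψ₀(t(ϖx)) = 1`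
    have hxO : x ∈ 𝒪[F] := (Valuation.mem_integer_iff _ _).2 hx
    have hmem : (⟨ϖ, hϖ.mem⟩ * ⟨x, hxO⟩ : 𝒪[F]) ∈ 𝓂[F] := by
      rw [hϖ.span_eq]
      exact Ideal.mul_mem_right _ _ (Ideal.mem_span_singleton_self _)
    have h1 := h𝓂 _ hmem
    rw [AddChar.mulShift_apply, Subring.coe_mul] at h1
    rw [AddChar.mulShift_apply, mul_assoc]
    exact h1
  · -- `v(ϖ⁻¹ y₀) ≤ v(ϖ)⁻¹`
    rw [map_mul, map_inv₀]
    exact mul_le_of_le_one_right zero_le ((Valuation.mem_integer_iff _ _).1 y₀.2)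
  · -- `ψ₀(tϖ · ϖ⁻¹y₀) = ψ₀(t y₀) ≠ 1`
    rw [AddChar.mulShift_apply, mul_assoc, mul_inv_cancel_left₀ hϖ0, ← AddChar.mulShift_apply]
    exact hy₀

/-- The two letters alone: **`∃ ψ : AddChar F Circle, (∀ x, valuation F x ≤ 1 → ψ x = 1) ∧ (∃ x, valuation F x ≤ (valuation F ϖ)⁻¹ ∧ ψ x ≠ 1)`** — the hypotheses `hψ` ∕ `hψ'` of ★ (S) (H-char) (C) (N) —
for any non-archimedean local field with a non-trivial continuous additive character. [cite: Bump1997, Exercise 3.1.1 (b) (PDF p. 266)] [cite: BushnellHenniart2006, §1.7] -/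
theorem exists_addChar_conductor_integers_of_exists {ϖ : F} (hϖ : IsUniformizingElement ϖ) (h : ∃ ψ₀ : AddChar F Circle, ψ₀.IsContinuousNontrivial) :
    ∃ ψ : AddChar F Circle, (∀ x : F, valuation F x ≤ 1 → ψ x = 1) ∧ ∃ x : F, valuation F x ≤ (valuation F ϖ)⁻¹ ∧ ψ x ≠ 1 := by
  obtain ⟨ψ₀, hψ₀⟩ := h
  obtain ⟨ψ, -, hψ, hψ'⟩ := exists_continuous_addChar_conductor_integers_of_isContinuousNontrivial hϖ hψ₀
  exact ⟨ψ, hψ, hψ'⟩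

omit [TopologicalSpace F] [IsNonarchimedeanLocalField F] in
/-- For `ϖ′` of valuation `< 1` and a uniformizing `ϖ`: `valuation F ϖ′ ≤ valuation F ϖ` (`ϖ′ ∈ 𝓂 = ϖ𝒪`). [folklore] -/
theorem valuation_le_of_isUniformizingElement {ϖ ϖ' : F} (hϖ : IsUniformizingElement ϖ) (hϖ' : valuation F ϖ' < 1) : valuation F ϖ' ≤ valuation F ϖ := by
  obtain ⟨y, hy, rfl⟩ := hϖ.exists_eq_mul ((Valuation.mem_integer_iff _ _).2 hϖ'.le) hϖ'
  rw [map_mul]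
  exact mul_le_of_le_one_right zero_le ((Valuation.mem_integer_iff _ _).1 hy)

/-- **UNIFORMIZER-FREE FORM**: one continuous `ψ` of conductor exactly `𝒪` serves every non-zero `ϖ′` with `valuation F ϖ′ < 1` — `∃ ψ, Continuous ψ ∧ (∀ x, v x ≤ 1 → ψ x = 1) ∧
∀ ϖ′ ≠ 0, v ϖ′ < 1 → ∃ x, v x ≤ (v ϖ′)⁻¹ ∧ ψ x ≠ 1` (for `ϖ′ = 0` the right-hand side would be false: `(v 0)⁻¹ = 0`). [cite: Bump1997, Exercise 3.1.1 (b) (PDF p. 266)]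
[cite: BushnellHenniart2006, §1.7] -/
theorem exists_addChar_conductor_integers_forall (h : ∃ ψ₀ : AddChar F Circle, ψ₀.IsContinuousNontrivial) :
    ∃ ψ : AddChar F Circle, Continuous ψ ∧ (∀ x : F, valuation F x ≤ 1 → ψ x = 1) ∧
      ∀ ϖ' : F, ϖ' ≠ 0 → valuation F ϖ' < 1 → ∃ x : F, valuation F x ≤ (valuation F ϖ')⁻¹ ∧ ψ x ≠ 1 := by
  obtain ⟨ψ₀, hψ₀⟩ := h
  -- a uniformizing element exists (`𝒪[F]` is a discrete valuation ring)
  obtain ⟨ϖ₀, hϖ₀⟩ := IsDiscreteValuationRing.exists_irreducible 𝒪[F]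
  have hϖ : IsUniformizingElement (ϖ₀ : F) :=
    ⟨ϖ₀.2, fun h0 => hϖ₀.ne_zero (Subtype.ext h0), by rw [(IsDiscreteValuationRing.irreducible_iff_uniformizer _).mp hϖ₀]⟩
  obtain ⟨ψ, hc, hψ, x, hx, hx1⟩ := exists_continuous_addChar_conductor_integers_of_isContinuousNontrivial hϖ hψ₀
  refine ⟨ψ, hc, hψ, fun ϖ' hϖ'0 hϖ' => ⟨x, hx.trans ?_, hx1⟩⟩
  have h0 : 0 < valuation F (ϖ₀ : F) := zero_lt_iff.2 ((Valuation.ne_zero_iff _).2 hϖ.ne_zero)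
  have h0' : 0 < valuation F ϖ' := zero_lt_iff.2 ((Valuation.ne_zero_iff _).2 hϖ'0)
  exact (inv_le_inv₀ h0 h0').2 (valuation_le_of_isUniformizingElement hϖ hϖ')

end Generic

/-! ## §2 Number fields: the completion `K_v` at a finite place -/

section NumberField

open NumberField IsDedekindDomain

variable (K : Type) [Field K] [NumberField K] (v : HeightOneSpectrum (𝓞 K))

/-- **(Psi) AT A FINITE PLACE OF A NUMBER FIELD, with continuity**: for `F := v.adicCompletion K` and any uniformizing `ϖ`, there is a CONTINUOUS `ψ : AddChar (v.adicCompletion K) Circle` with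
`ψ x = 1` for `valuation _ x ≤ 1` and `ψ x ≠ 1` for some `x` with `valuation _ x ≤ (valuation _ ϖ)⁻¹` — §1 applied to the local component `ψ_v` of Tate's character of `𝔸_K ⧸ K`
(★ `isContinuousNontrivial_adeleAddCharAt`). [cite: CasselsFrohlichANT1967, Ch. XV (Tate), Lemma 2.2.3] [cite: Bump1997, Exercise 3.1.1 (b) (PDF p. 266)] -/
theorem exists_continuous_addChar_adicCompletion {ϖ : v.adicCompletion K} (hϖ : IsUniformizingElement ϖ) :
    ∃ ψ : AddChar (v.adicCompletion K) Circle, Continuous ψ ∧ (∀ x : v.adicCompletion K, valuation (v.adicCompletion K) x ≤ 1 → ψ x = 1) ∧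
      ∃ x : v.adicCompletion K, valuation (v.adicCompletion K) x ≤ (valuation (v.adicCompletion K) ϖ)⁻¹ ∧ ψ x ≠ 1 :=
  exists_continuous_addChar_conductor_integers_of_isContinuousNontrivial hϖ (isContinuousNontrivial_adeleAddCharAt K v)

/-- **(Psi) AT A FINITE PLACE OF A NUMBER FIELD — the two letters `hψ` ∕ `hψ'` of ★ (S) (H-char) (C) (N) verbatim**: for `F := v.adicCompletion K` (e.g. `w.adicCompletion L`, `w` a finite place of the
CM field `L`) and any uniformizing `ϖ`: `∃ ψ : AddChar F Circle, (∀ x, valuation F x ≤ 1 → ψ x = 1) ∧ (∃ x, valuation F x ≤ (valuation F ϖ)⁻¹ ∧ ψ x ≠ 1)`.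
[cite: CasselsFrohlichANT1967, Ch. XV (Tate), Lemma 2.2.3] [cite: Bump1997, Exercise 3.1.1 (b) (PDF p. 266)] -/
theorem exists_addChar_adicCompletion {ϖ : v.adicCompletion K} (hϖ : IsUniformizingElement ϖ) :
    ∃ ψ : AddChar (v.adicCompletion K) Circle, (∀ x : v.adicCompletion K, valuation (v.adicCompletion K) x ≤ 1 → ψ x = 1) ∧
      ∃ x : v.adicCompletion K, valuation (v.adicCompletion K) x ≤ (valuation (v.adicCompletion K) ϖ)⁻¹ ∧ ψ x ≠ 1 :=
  exists_addChar_conductor_integers_of_exists hϖ ⟨_, isContinuousNontrivial_adeleAddCharAt K v⟩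

/-- **(Psi), uniformizer-free, at a finite place of a number field**: one continuous `ψ` on `K_v`, trivial on `𝒪_v`, with `ψ x ≠ 1` for some `x` of valuation `≤ (valuation _ ϖ′)⁻¹`, for EVERY
non-zero `ϖ′` of valuation `< 1`. [cite: CasselsFrohlichANT1967, Ch. XV (Tate), Lemma 2.2.3] [cite: Bump1997, Exercise 3.1.1 (b) (PDF p. 266)] -/
theorem exists_addChar_adicCompletion_forall :
    ∃ ψ : AddChar (v.adicCompletion K) Circle, Continuous ψ ∧ (∀ x : v.adicCompletion K, valuation (v.adicCompletion K) x ≤ 1 → ψ x = 1) ∧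
      ∀ ϖ' : v.adicCompletion K, ϖ' ≠ 0 → valuation (v.adicCompletion K) ϖ' < 1 →
        ∃ x : v.adicCompletion K, valuation (v.adicCompletion K) x ≤ (valuation (v.adicCompletion K) ϖ')⁻¹ ∧ ψ x ≠ 1 :=
  exists_addChar_conductor_integers_forall ⟨_, isContinuousNontrivial_adeleAddCharAt K v⟩

end NumberField

end Summit.HodgeConjecture.HodgeConjecture.Cruxes.H413.K2E3LocalAdditiveCharacterLevelOne

end
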